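import Summits.Ventures.CertifiedManyBodySolver.Upper.UMPSCellBookkeeping
import Summits.Ventures.CertifiedManyBodySolver.Upper.UMPSPolarCorrection
import Summits.Ventures.CertifiedManyBodySolver.Statement

/-!
# uMPS upper bound for the Hubbard chain, VI: Theorem U1 for two-site cells

HONEST FRAMING: first certified bounds; not a superconductivity verdict; every number certified or
labelled float.

Venture `Ventures/CertifiedManyBodySolver` (sr-mbsolver). **Theorem U1 of VAR's `METHOD-umps.md` for the
certificates of record** (`FORMAT-umps1.md`, `ncell = 2`): a uniform MPS `A : Fin 16 → M_D(ℂ)` on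
two-site cells, exactly left-isometric, a matrix `Z` and reals `c, z` with
`c·1 − W(A; hh, Z) ⪰ 0`, `z·1 ∓ Z ⪰ 0` (`W = Y_hh + Φ(Z) − Z` = `dualMatrix A (cellBondMatrix t U) Z`,
`hh = cellBondMatrix t U`) give `2 e(t,U) ≤ c`. Assembled exactly as the one-site-cell theorem
(`Upper/UMPSEnergyBound.lean`), with the chain of `(n+2)·2` sites blocked into `n + 2` cells:

* `cellTrialDensity A r n` — the trial density matrix `Σ_l |φ̃_l⟩⟨φ̃_l|` on the Fock space of the open
  chain of `(n+2)·2` sites, `φ̃_l` = Jordan–Wigner preimage of the UNBLOCKED open MPS vector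
  `σ ↦ (mpsOpen (n+2) A e_l r) (blockCfg σ)`; `Tr(ρ X) = gmixture(blockOp (toSpin X))`, `Tr ρ = ‖r‖²`;
* `groundEnergyAt_pathGraph_cell_le_of_umps_dual` — `E_{path(4n+8)}(4n+8) ≤ 2((n+1)c + 2z) + 8|t| + 6U`
  ((d) `groundEnergyAt_pathGraph_double_le_re_trace` + (c) `bookkeeping_cell_le` + (a)(b)
  `re_sum_star_mpsOpen_dotProduct_bondSum_mulVec_le` at `q = 16`);
* `hubbardChainEnergyDensity_le_of_umps_cell_dual` — **`2 · hubbardChainEnergyDensity t U ≤ c`**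
  ((e) `hubbardChainEnergyDensity_le_segment` + `le_of_forall_le_div_succ`), and the per-site form
  `hubbardChainEnergyDensity_le_half_of_umps_cell_dual : hubbardChainEnergyDensity t U ≤ c / 2`;
* `hubbardChainEnergyDensity_le_of_umps_cell_dual_dyadic` (`_of_rowSum`) — the same for the STORED
  dyadic tensor of a certificate file (nearly isometric, `‖Σ_S (A S)ᴴ A S − 1‖_∞ ≤ ε < 1`) with the
  Lemma-P slack `η` of METHOD-umps §3, through lit-1's `polarTensor_dual_certificate`
  (`Upper/UMPSPolarCorrection.lean`, generic in the physical dimension);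
* `m1EnergyUpperRow_of_umps_cell_dual`, `m1EnergyUpperRow_of_umps_dual`,
  `m1EnergyUpperRow_of_umps_cell_dual_dyadic_of_rowSum` — the Venture rows `M1EnergyUpperRow U q`
  (`Statement.lean`, `t = 1`) from an `ncell = 2` / `ncell = 1` certificate (per-cell bound
  `qcell = 2 qsite`, exact rationals as in `FORMAT-umps1.md`; the last one takes the readers' numbers
  `eps0`, `g_inf`, `Z_inf`, `eta_prime` by value).

Index conventions for instances: cell index `S = cellIndex (k₀, k₁) = 4 k₀ + k₁` (`k₀` left site),
one-site index the tree's `0 = ∅, 1 = ↑, 2 = ↓, 3 = ↑↓` (VAR's files: `s = 2 n↑ + n↓`, swap `1 ↔ 2`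
on each leg, then `S = 4 s₁ + s₂`).
-/

noncomputable section

open Matrix Finset Filter Topology
open scoped ComplexOrder BigOperators Kronecker

namespace Summit.Ventures.CertifiedManyBodySolver.Upper

open Literature.MathematicalPhysics.QuantumLattice
open Literature.MathematicalPhysics.QuantumLattice.JordanWigner
open Literature.MathematicalPhysics.QuantumLattice.ThermodynamicLimit

variable {D : ℕ}

/-! ### The cell trial density matrix on Fock space -/

/-- The trial density matrix `ρ = Σ_l |φ̃_l⟩⟨φ̃_l|` on the Fock space of the open chain of `(n+2)·2`
sites, `φ̃_l = toSpinVec⁻¹ (σ ↦ (mpsOpen (n+2) A e_l r) (blockCfg (n+2) σ))` (the open cell-MPS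
vectors, unblocked and read through the site-major Jordan–Wigner identification). -/
def cellTrialDensity (A : MPSTensor 16 D) (r : Fin D → ℂ) (n : ℕ) :
    Matrix (Finset (Orb (Fin ((n + 2) * 2)))) (Finset (Orb (Fin ((n + 2) * 2)))) ℂ :=
  ∑ l : Fin D,
    vecMulVec (toSpinVec.symm (fun σ => mpsOpen (n + 2) A (Pi.single l 1) r (blockCfg (n + 2) σ)))
      (star (toSpinVec.symm (fun σ => mpsOpen (n + 2) A (Pi.single l 1) r (blockCfg (n + 2) σ))))

variable (A : MPSTensor 16 D) (r : Fin D → ℂ) (n : ℕ)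

/-- `ρ ⪰ 0`. -/
theorem posSemidef_cellTrialDensity : (cellTrialDensity A r n).PosSemidef := by
  unfold cellTrialDensity
  refine Finset.sum_induction _ (fun M => Matrix.PosSemidef M) (fun a b ha hb => ha.add hb)
    Matrix.PosSemidef.zero ?_
  intro l _
  exact posSemidef_vecMulVec_self_star _

/-- `Tr(ρ X) = gmixture(blockOp (toSpin X))`: Fock-space expectations of `ρ` are the cell-tensor-side
mixture expectations of the blocked Jordan–Wigner image. -/
theorem trace_cellTrialDensity_mul
    (X : Matrix (Finset (Orb (Fin ((n + 2) * 2)))) (Finset (Orb (Fin ((n + 2) * 2)))) ℂ) :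
    (cellTrialDensity A r n * X).trace = gmixture A r n (blockOp (n + 2) (toSpin X)) := by
  rw [cellTrialDensity, Finset.sum_mul, trace_sum, gmixture]
  refine Finset.sum_congr rfl fun l _ => ?_
  rw [trace_vecMulVec_star_mul_eq_dotProduct_mulVec]
  have h := expect_eq X
    (toSpinVec.symm (fun σ => mpsOpen (n + 2) A (Pi.single l 1) r (blockCfg (n + 2) σ)))
  rw [LinearEquiv.apply_symm_apply, Literature.MathematicalPhysics.QuantumLattice.expect] at h
  rw [h]
  exact star_comp_blockCfg_dotProduct_mulVec (n + 2) (toSpin X) _ _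

/-- `Tr ρ = ‖r‖²` for a left-isometric tensor. -/
theorem trace_cellTrialDensity (hA : ∑ s, (A s)ᴴ * A s = 1) :
    (cellTrialDensity A r n).trace = star r ⬝ᵥ r := by
  rw [← Matrix.mul_one (cellTrialDensity A r n), trace_cellTrialDensity_mul, map_one, map_one, gmixture]
  simp only [Matrix.one_mulVec]
  exact sum_star_mpsOpen_dotProduct_mpsOpen_eq hA (n + 2) r

variable {A r}

/-! ### Theorem U1 for cells -/

/-- **Finite-volume form**: for a left-isometric cell tensor `A`, a unit `r`, `U ≥ 0` and the three
certificates (with `hh = cellBondMatrix t U`), the half-filled open chain of `4n + 8` sites obeys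
`E_{path(4n+8)}(4n+8) ≤ 2((n+1)c + 2z) + 8|t| + 6U`. -/
theorem groundEnergyAt_pathGraph_cell_le_of_umps_dual (hA : ∑ s, (A s)ᴴ * A s = 1)
    (hr : star r ⬝ᵥ r = 1) (t : ℝ) {U : ℝ} (hU : 0 ≤ U) (Z : Matrix (Fin D) (Fin D) ℂ) {c z : ℝ}
    (hW : ((c : ℂ) • (1 : Matrix (Fin D) (Fin D) ℂ) - dualMatrix A (cellBondMatrix t U) Z).PosSemidef)
    (hZ₁ : ((z : ℂ) • (1 : Matrix (Fin D) (Fin D) ℂ) - Z).PosSemidef)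
    (hZ₂ : ((z : ℂ) • (1 : Matrix (Fin D) (Fin D) ℂ) + Z).PosSemidef) (n : ℕ) :
    groundEnergyAt (SimpleGraph.pathGraph ((n + 2) * 2 + (n + 2) * 2)) t U ((n + 2) * 2 + (n + 2) * 2) ≤
      2 * (((n : ℝ) + 1) * c + 2 * z) + 8 * |t| + 6 * U := by
  have htr : (cellTrialDensity A r n).trace = 1 := by rw [trace_cellTrialDensity A r n hA, hr]
  have hd := groundEnergyAt_pathGraph_double_le_re_trace ((n + 2) * 2) t U
    (posSemidef_cellTrialDensity A r n) htr
  rw [trace_cellTrialDensity_mul, trace_cellTrialDensity_mul] at hd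
  have hb := bookkeeping_cell_le n hA hr t hU
  have ht : (gmixture A r n (bondSum n (cellBondMatrix t U))).re ≤ ((n : ℝ) + 1) * c + 2 * z :=
    re_sum_star_mpsOpen_dotProduct_bondSum_mulVec_le hA hr (cellBondMatrix t U) Z hW hZ₁ hZ₂ n
  have hcast : ((((n + 2) * 2 : ℕ)) : ℝ) = 2 * ((n : ℝ) + 2) := by push_cast; ring
  rw [hcast] at hd
  linarith

/-- **Theorem U1 for two-site cells (uMPS dual certificate of record ⇒ TL upper bound).**
Let `A : Fin 16 → M_D(ℂ)` (`D ≥ 1`) be exactly left-isometric, `Σ_S (A S)ᴴ A S = 1`, let `U ≥ 0`,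
`t` real, `Z ∈ M_D(ℂ)` arbitrary, and let `c, z` be reals with `c·1 − (Y_hh + Φ(Z) − Z) ⪰ 0`
(`hh = cellBondMatrix t U`), `z·1 − Z ⪰ 0`, `z·1 + Z ⪰ 0`. Then `2 · hubbardChainEnergyDensity t U ≤ c`.
No injectivity, gap or fixed point of `A` is used; `z` only enters the finite-size constant. -/
theorem hubbardChainEnergyDensity_le_of_umps_cell_dual (A : MPSTensor 16 D) (hD : 0 < D)
    (hA : ∑ s, (A s)ᴴ * A s = 1) (t : ℝ) {U : ℝ} (hU : 0 ≤ U) (Z : Matrix (Fin D) (Fin D) ℂ)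
    {c z : ℝ}
    (hW : ((c : ℂ) • (1 : Matrix (Fin D) (Fin D) ℂ) - dualMatrix A (cellBondMatrix t U) Z).PosSemidef)
    (hZ₁ : ((z : ℂ) • (1 : Matrix (Fin D) (Fin D) ℂ) - Z).PosSemidef)
    (hZ₂ : ((z : ℂ) • (1 : Matrix (Fin D) (Fin D) ℂ) + Z).PosSemidef) :
    2 * hubbardChainEnergyDensity t U ≤ c := by
  set r : Fin D → ℂ := Pi.single (⟨0, hD⟩ : Fin D) 1 with hr_def
  have hr : star r ⬝ᵥ r = 1 := by
    simp [hr_def]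
  suffices h : hubbardChainEnergyDensity t U ≤ c / 2 by linarith
  refine le_of_forall_le_div_succ _ (c / 2) (z + 2 * |t| + 3 / 2 * U) fun n => ?_
  have hN : (1 : ℕ) ≤ (n + 2) * 2 + (n + 2) * 2 := by omega
  have hseg := hubbardChainEnergyDensity_le_segment t hU hN
  have hfin := groundEnergyAt_pathGraph_cell_le_of_umps_dual hA hr t hU Z hW hZ₁ hZ₂ n
  have hpos : (0 : ℝ) < ((((n + 2) * 2 + (n + 2) * 2 : ℕ)) : ℝ) := by positivity
  have hcast : ((((n + 2) * 2 + (n + 2) * 2 : ℕ)) : ℝ) = 4 * ((n : ℝ) + 2) := by push_cast; ring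
  have h1 := hseg.trans (div_le_div_of_nonneg_right hfin hpos.le)
  rw [hcast] at h1
  refine h1.trans_eq ?_
  rw [div_eq_div_iff (by positivity) (by positivity)]
  ring

/-- Theorem U1 for two-site cells, per-site form: `hubbardChainEnergyDensity t U ≤ c / 2`. -/
theorem hubbardChainEnergyDensity_le_half_of_umps_cell_dual (A : MPSTensor 16 D) (hD : 0 < D)
    (hA : ∑ s, (A s)ᴴ * A s = 1) (t : ℝ) {U : ℝ} (hU : 0 ≤ U) (Z : Matrix (Fin D) (Fin D) ℂ)
    {c z : ℝ}
    (hW : ((c : ℂ) • (1 : Matrix (Fin D) (Fin D) ℂ) - dualMatrix A (cellBondMatrix t U) Z).PosSemidef)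
    (hZ₁ : ((z : ℂ) • (1 : Matrix (Fin D) (Fin D) ℂ) - Z).PosSemidef)
    (hZ₂ : ((z : ℂ) • (1 : Matrix (Fin D) (Fin D) ℂ) + Z).PosSemidef) :
    hubbardChainEnergyDensity t U ≤ c / 2 := by
  have h := hubbardChainEnergyDensity_le_of_umps_cell_dual A hD hA t hU Z hW hZ₁ hZ₂
  linarith

/-! ### Theorem U1 for cells from a DYADIC certificate (Lemma P, `UMPSPolarCorrection`) -/

/-- **Theorem U1 for two-site cells, stored dyadic tensor** (`hubbardChainEnergyDensity_le_of_umps_cell_dual`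
∘ `polarTensor_dual_certificate` at `q = 16`, `X = cellBondMatrix t U`). Readers' inputs: the dyadic
`A : Fin 16 → M_D(ℂ)` (`D ≥ 1`), the max row sum `ε < 1` of `Σ_S (A S)ᴴ(A S) − 1`, `γ ≥ 0` with
`γ·1 ± hh ⪰ 0`, any `Z` with `z·1 ± Z ⪰ 0` (`z ≥ 0`), `η ≥ (1 + 1/(1−ε))·(ε/(1−ε))·(1+ε)·(γ(1+(1+ε)) + z)`
and the exact-arithmetic certificate `(q − η)·1 − W(A; hh, Z) ⪰ 0`. Conclusion: `2 e(t,U) ≤ q`. -/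
theorem hubbardChainEnergyDensity_le_of_umps_cell_dual_dyadic (A : MPSTensor 16 D) (hD : 0 < D)
    {ε γ z η q : ℝ} (hε0 : 0 ≤ ε) (hε1 : ε < 1) (hγ : 0 ≤ γ) (hz : 0 ≤ z)
    (hG : ∀ i, ∑ j, ‖(gram A - 1) i j‖ ≤ ε) (t : ℝ) {U : ℝ} (hU : 0 ≤ U)
    (hX₁ : ((γ : ℂ) • (1 : Matrix (Fin 16 × Fin 16) (Fin 16 × Fin 16) ℂ) - cellBondMatrix t U).PosSemidef)
    (hX₂ : ((γ : ℂ) • (1 : Matrix (Fin 16 × Fin 16) (Fin 16 × Fin 16) ℂ) + cellBondMatrix t U).PosSemidef)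
    (Z : Matrix (Fin D) (Fin D) ℂ)
    (hZ₁ : ((z : ℂ) • (1 : Matrix (Fin D) (Fin D) ℂ) - Z).PosSemidef)
    (hZ₂ : ((z : ℂ) • (1 : Matrix (Fin D) (Fin D) ℂ) + Z).PosSemidef)
    (hη : (1 + 1 / (1 - ε)) * (ε / (1 - ε)) * (1 + ε) * (γ * (1 + (1 + ε)) + z) ≤ η)
    (hW : (((q - η : ℝ) : ℂ) • (1 : Matrix (Fin D) (Fin D) ℂ) -
      dualMatrix A (cellBondMatrix t U) Z).PosSemidef) :
    2 * hubbardChainEnergyDensity t U ≤ q := by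
  obtain ⟨hA, hW'⟩ := polarTensor_dual_certificate hε0 hε1 hγ hz hG hX₁ hX₂ hZ₁ hZ₂ hη hW
  exact hubbardChainEnergyDensity_le_of_umps_cell_dual (polarTensor A) hD hA t hU Z hW' hZ₁ hZ₂

/-- The same with max row sums for `hh` and `Z` (`g_inf`, `Z_inf` of the verifiers) in place of the
PSD sandwiches. -/
theorem hubbardChainEnergyDensity_le_of_umps_cell_dual_dyadic_of_rowSum (A : MPSTensor 16 D)
    (hD : 0 < D) {ε γ z η q : ℝ} (hε0 : 0 ≤ ε) (hε1 : ε < 1) (hγ : 0 ≤ γ) (hz : 0 ≤ z)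
    (hG : ∀ i, ∑ j, ‖(gram A - 1) i j‖ ≤ ε) (t : ℝ) {U : ℝ} (hU : 0 ≤ U)
    (hgh : (cellBondMatrix t U).IsHermitian) (hg : ∀ p, ∑ p', ‖cellBondMatrix t U p p'‖ ≤ γ)
    (Z : Matrix (Fin D) (Fin D) ℂ) (hZh : Z.IsHermitian) (hZ : ∀ i, ∑ j, ‖Z i j‖ ≤ z)
    (hη : (1 + 1 / (1 - ε)) * (ε / (1 - ε)) * (1 + ε) * (γ * (1 + (1 + ε)) + z) ≤ η)
    (hW : (((q - η : ℝ) : ℂ) • (1 : Matrix (Fin D) (Fin D) ℂ) -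
      dualMatrix A (cellBondMatrix t U) Z).PosSemidef) :
    2 * hubbardChainEnergyDensity t U ≤ q := by
  obtain ⟨hA, hW', hZ₁, hZ₂⟩ :=
    polarTensor_dual_certificate_of_rowSum hε0 hε1 hγ hz hG hgh hg hZh hZ hη hW
  exact hubbardChainEnergyDensity_le_of_umps_cell_dual (polarTensor A) hD hA t hU Z hW' hZ₁ hZ₂

/-! ### The Venture rows -/

/-- **The Venture row from an `ncell = 2` certificate** (`FORMAT-umps1.md`: per-cell bound `qcell`,
per-site bound `qsite`, `qcell = 2 · qsite`, `t = 1`): `M1EnergyUpperRow U qsite`. -/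
theorem m1EnergyUpperRow_of_umps_cell_dual (A : MPSTensor 16 D) (hD : 0 < D)
    (hA : ∑ s, (A s)ᴴ * A s = 1) {U : ℝ} (hU : 0 ≤ U) (Z : Matrix (Fin D) (Fin D) ℂ)
    {qcell qsite : ℚ} (hq : qcell = 2 * qsite) {z : ℝ}
    (hW : ((((qcell : ℚ) : ℝ) : ℂ) • (1 : Matrix (Fin D) (Fin D) ℂ) -
      dualMatrix A (cellBondMatrix 1 U) Z).PosSemidef)
    (hZ₁ : ((z : ℂ) • (1 : Matrix (Fin D) (Fin D) ℂ) - Z).PosSemidef)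
    (hZ₂ : ((z : ℂ) • (1 : Matrix (Fin D) (Fin D) ℂ) + Z).PosSemidef) :
    M1EnergyUpperRow U qsite := by
  have h := hubbardChainEnergyDensity_le_of_umps_cell_dual A hD hA 1 hU Z hW hZ₁ hZ₂
  unfold M1EnergyUpperRow
  rw [hq] at h
  push_cast at h
  linarith

/-- **The Venture row from an `ncell = 2` certificate FILE, by the readers' numbers** (`t = 1`): the
stored dyadic `A`, `ε = eps0` (max row sum of `Σ_S (A S)ᴴ A S − 1`, `< 1`), `γ = g_inf` and
`z = Z_inf` (max row sums of the Hermitian `hh = cellBondMatrix 1 U` and `Z`), `η = eta_prime` with the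
METHOD-umps §3 inequality, the PSD certificate `(qcell − η)·1 − W(A; hh, Z) ⪰ 0`, and `qcell = 2 qsite`:
`M1EnergyUpperRow U qsite`. -/
theorem m1EnergyUpperRow_of_umps_cell_dual_dyadic_of_rowSum (A : MPSTensor 16 D) (hD : 0 < D)
    {ε γ z η : ℝ} (hε0 : 0 ≤ ε) (hε1 : ε < 1) (hγ : 0 ≤ γ) (hz : 0 ≤ z)
    (hG : ∀ i, ∑ j, ‖(gram A - 1) i j‖ ≤ ε) {U : ℝ} (hU : 0 ≤ U)
    (hgh : (cellBondMatrix 1 U).IsHermitian) (hg : ∀ p, ∑ p', ‖cellBondMatrix 1 U p p'‖ ≤ γ)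
    (Z : Matrix (Fin D) (Fin D) ℂ) (hZh : Z.IsHermitian) (hZ : ∀ i, ∑ j, ‖Z i j‖ ≤ z)
    (hη : (1 + 1 / (1 - ε)) * (ε / (1 - ε)) * (1 + ε) * (γ * (1 + (1 + ε)) + z) ≤ η)
    {qcell qsite : ℚ} (hq : qcell = 2 * qsite)
    (hW : ((((qcell : ℝ) - η : ℝ) : ℂ) • (1 : Matrix (Fin D) (Fin D) ℂ) -
      dualMatrix A (cellBondMatrix 1 U) Z).PosSemidef) :
    M1EnergyUpperRow U qsite := by
  have h := hubbardChainEnergyDensity_le_of_umps_cell_dual_dyadic_of_rowSum A hD hε0 hε1 hγ hz hG 1 hU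
    hgh hg Z hZh hZ hη hW
  unfold M1EnergyUpperRow
  rw [hq] at h
  push_cast at h
  linarith

/-- **The Venture row from an `ncell = 1` certificate** (`t = 1`): `M1EnergyUpperRow U q`. -/
theorem m1EnergyUpperRow_of_umps_dual (A : MPSTensor 4 D) (hD : 0 < D)
    (hA : ∑ s, (A s)ᴴ * A s = 1) {U : ℝ} (hU : 0 ≤ U) (Z : Matrix (Fin D) (Fin D) ℂ) {q : ℚ} {z : ℝ}
    (hW : ((((q : ℚ) : ℝ) : ℂ) • (1 : Matrix (Fin D) (Fin D) ℂ) -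
      dualMatrix A (bondMatrix 1 U) Z).PosSemidef)
    (hZ₁ : ((z : ℂ) • (1 : Matrix (Fin D) (Fin D) ℂ) - Z).PosSemidef)
    (hZ₂ : ((z : ℂ) • (1 : Matrix (Fin D) (Fin D) ℂ) + Z).PosSemidef) :
    M1EnergyUpperRow U q :=
  hubbardChainEnergyDensity_le_of_umps_dual A hD hA 1 hU Z hW hZ₁ hZ₂

end Summit.Ventures.CertifiedManyBodySolver.Upper

end
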